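import Summits.KontsevichZagierPeriods.KontsevichZagierPeriods.Theorems.LinRedNormalFormArrangementNormalFormSeparateTwoZeroVanish
import Summits.KontsevichZagierPeriods.KontsevichZagierPeriods.Theorems.LinRedNormalFormArrangementNormalFormSeparateTwoZeroWeights
import Summits.KontsevichZagierPeriods.KontsevichZagierPeriods.Theorems.LinRedNormalFormArrangementNormalFormSeparateTwoZeroCone
import Summits.KontsevichZagierPeriods.KontsevichZagierPeriods.Theorems.LinRedNormalFormArrangementNormalFormSeparateTwoZeroAux

/-!
# The local core of the power counting at a point of the pole line

(Line `janus-bands`, crux `ArrangementNormalForm`, stub `stub_separateTwoZero` — separation in a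
good rational direction for PLANAR arrangement representations without fibres; part `Core`.)

`core` (registered as `separateTwoZero_core`): at a point of the pole line adherent to the
chart polygon, every Taylor piece `qᵢ(u)/(u^E W₁(u)) · λ^i/λ^n` of an absolutely integrable
`F = p(u,λ)/(u^E W₁(u)) · λ^{-n}` is absolutely integrable on the polygon near the point, GIVEN the
exponent inequality `n + E < D + 2` for the order `D` of `p` (part `Lower`). Ingredients: the
dichotomy transversal pole line (`|u| ≤ C|λ|`) / polar edge (band ⟹ `qᵢ = 0` for `i < n`,
`dichotomy`), the upper power bound `|pieceᵢ| ≤ C r^D/r^{n+E}` (`abs_piece_le`), and the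
integrable weight `r⁻¹`.
-/

noncomputable section

open Set MeasureTheory Filter Topology
open scoped ENNReal

namespace Summit.KontsevichZagierPeriods.ArrangementNormalForm.JanusBands

namespace SepTwoZero

section OmInfra

variable {J : ℕ} (g : Fin J → ℝ × ℝ × ℝ)

/-- The open polygon is measurable. -/
theorem measurableSet_Om : MeasurableSet (Om g) := (isOpen_Om g).measurableSet

/-- A bounded measurable function is integrable on the polygon near the origin. -/
theorem integrableOn_Om_of_bdd {f : ℝ × ℝ → ℝ} (hf : Measurable f) {ρ C : ℝ}
    (hb : ∀ w ∈ Om g ∩ box ρ, |f w| ≤ C) : IntegrableOn f (Om g ∩ box ρ) :=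
  integrableOn_of_bdd hf ((measurableSet_Om g).inter (measurableSet_box ρ))
    ((measure_mono inter_subset_right).trans_lt (by
      rw [box_eq]; exact volume_prod_Ioo_lt_top _ _ _ _)) hb

end OmInfra

section Bounds

variable {J : ℕ} (g : Fin J → ℝ × ℝ × ℝ)

/-- **Upper power bound for a Taylor piece** near the origin:
`|pieceᵢ| ≤ C · r^D / r^{n+E}`, `r = |u| + |λ|`, in the regular (`n ≤ i`) or transversal
(`r ≤ K |λ|` on the polygon) case. -/
theorem abs_piece_le {N N' D n E i : ℕ} (c : ℕ × ℕ → ℝ) (Q : ℕ → ℝ → ℝ)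
    (hQ : ∀ i u, Q i u = ∑ m ∈ Finset.range N', c (i, m) * u ^ m)
    (hd : ∀ im ∈ Finset.range N ×ˢ Finset.range N', c im ≠ 0 → D ≤ im.1 + im.2) (hi : i < N)
    (W₁ : ℝ → ℝ) (hW0 : W₁ 0 ≠ 0) {ρ ρW : ℝ} (hρW : ρ ≤ ρW) (hρ1 : ρ ≤ 1 / 2)
    (hWlow : ∀ u : ℝ, |u| < ρW → |W₁ 0| / 2 ≤ |W₁ u|)
    (hnE : n ≠ 0 ∨ E ≠ 0) (hpole : n ≠ 0 → ∀ w ∈ Om g, w.2 ≠ 0)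
    {K : ℝ} (hK : 1 ≤ K) (hgood : n ≤ i ∨ ∀ w ∈ Om g, |w.1| + |w.2| ≤ K * |w.2|)
    {K₂ : ℝ} (hK₂ : 1 ≤ K₂) (hcone : E ≠ 0 → ∀ w ∈ Om g, |w.1| + |w.2| ≤ K₂ * |w.1|) :
    ∀ w ∈ Om g ∩ box ρ, |piece Q W₁ E n i w| ≤
      ((∑ im ∈ Finset.range N ×ˢ Finset.range N', |c im|) * K ^ n * K₂ ^ E * (2 / |W₁ 0|)) *
        ((|w.1| + |w.2|) ^ D / (|w.1| + |w.2|) ^ (n + E)) := by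
  rintro w ⟨hw, hb1, hb2⟩
  set Cc := ∑ im ∈ Finset.range N ×ˢ Finset.range N', |c im| with hCc
  have hCc0 : 0 ≤ Cc := Finset.sum_nonneg fun _ _ => abs_nonneg _
  have hW00 : 0 < |W₁ 0| := abs_pos.2 hW0
  set r := |w.1| + |w.2| with hr
  rcases (show 0 ≤ r by positivity).lt_or_eq with hr0 | hr0
  · -- the generic point
    have hr1 : r ≤ 1 := by rw [hr]; linarith
    have hu1 : |w.1| ≤ 1 := by linarith [abs_nonneg w.2]
    have hur : |w.1| ≤ r := by rw [hr]; linarith [abs_nonneg w.2]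
    have hlr : |w.2| ≤ r := by rw [hr]; linarith [abs_nonneg w.1]
    have hQb : |Q i w.1| ≤ Cc * |w.1| ^ (D - i) := by
      rw [hQ]; exact abs_coeff_le c hd hi hu1
    have h1 : |w.1| ^ (D - i) * (|w.2| ^ i / |w.2| ^ n) ≤ K ^ n * (r ^ D / r ^ n) := by
      rcases hgood with hni | hgood
      · calc _ ≤ r ^ D / r ^ n := pow_bound_of_le hr0 hr1 hur hlr hni (by omega)
          _ ≤ K ^ n * (r ^ D / r ^ n) := le_mul_of_one_le_left (by positivity) (one_le_pow₀ hK)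
      · rcases le_or_gt n i with hni | hin
        · calc _ ≤ r ^ D / r ^ n := pow_bound_of_le hr0 hr1 hur hlr hni (by omega)
            _ ≤ K ^ n * (r ^ D / r ^ n) := le_mul_of_one_le_left (by positivity) (one_le_pow₀ hK)
        · exact pow_bound_of_lt hr0 hr1 hur hK (hgood w hw) hin (by omega)
    have h2 : 1 / |w.1| ^ E ≤ K₂ ^ E / r ^ E := by
      rcases Nat.eq_zero_or_pos E with hE | hE
      · simp [hE]
      · exact inv_pow_bound hr0 (hcone hE.ne' w hw) E
    have h3 : 1 / |W₁ w.1| ≤ 2 / |W₁ 0| := by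
      have := hWlow w.1 (hb1.trans_le hρW)
      rw [div_le_div_iff₀ (by linarith) hW00]; linarith
    have hexp : |piece Q W₁ E n i w| =
        |Q i w.1| * (|w.2| ^ i / |w.2| ^ n) * (1 / |w.1| ^ E) * (1 / |W₁ w.1|) := by
      simp only [piece, abs_mul, abs_div, abs_pow]; ring
    rw [hexp]
    calc |Q i w.1| * (|w.2| ^ i / |w.2| ^ n) * (1 / |w.1| ^ E) * (1 / |W₁ w.1|)
        ≤ (Cc * |w.1| ^ (D - i)) * (|w.2| ^ i / |w.2| ^ n) * (K₂ ^ E / r ^ E) * (2 / |W₁ 0|) := by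
          gcongr
      _ = Cc * (K₂ ^ E / r ^ E) * (2 / |W₁ 0|) * (|w.1| ^ (D - i) * (|w.2| ^ i / |w.2| ^ n)) := by
          ring
      _ ≤ Cc * (K₂ ^ E / r ^ E) * (2 / |W₁ 0|) * (K ^ n * (r ^ D / r ^ n)) := by gcongr
      _ = (Cc * K ^ n * K₂ ^ E * (2 / |W₁ 0|)) * (r ^ D / r ^ (n + E)) := by
          rw [pow_add]; field_simp
  · -- the origin (only possible in the pure wall case)
    have hu0 : w.1 = 0 := by
      have : |w.1| = 0 := by linarith [abs_nonneg w.1, abs_nonneg w.2]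
      exact abs_eq_zero.1 this
    have hl0 : w.2 = 0 := by
      have : |w.2| = 0 := by linarith [abs_nonneg w.1, abs_nonneg w.2]
      exact abs_eq_zero.1 this
    have hE : E ≠ 0 := by
      rcases hnE with hn | hE
      · exact absurd hl0 (hpole hn w hw)
      · exact hE
    have hp : piece Q W₁ E n i w = 0 := by
      simp [piece, hu0, zero_pow hE]
    rw [hp, abs_zero]
    positivity

end Bounds

section CoreThm

variable {J : ℕ} (g : Fin J → ℝ × ℝ × ℝ)

/-- **The band/transversal dichotomy.** Either `r ≤ K |λ|` on the polygon, or (edge case) the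
Taylor coefficients `qᵢ`, `i < n`, vanish identically. -/
theorem dichotomy {N N' n E : ℕ} (c : ℕ × ℕ → ℝ) (Q : ℕ → ℝ → ℝ)
    (hQ : ∀ i u, Q i u = ∑ m ∈ Finset.range N', c (i, m) * u ^ m)
    (W₁ : ℝ → ℝ) (hW0 : W₁ 0 ≠ 0) {ρW CW : ℝ} (hρW1 : ρW ≤ 1)
    (hWb : ∀ u : ℝ, |u| < ρW → |W₁ 0| / 2 ≤ |W₁ u| ∧ |W₁ u| ≤ CW)
    (h0 : ∀ j, 0 ≤ aff (g j) 0) (hne : (Om g).Nonempty) (hρW : 0 < ρW)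
    (F : ℝ × ℝ → ℝ) (hF : IntegrableOn F (Om g))
    (hFeq : EqOn F (fun w => (∑ i ∈ Finset.range N, Q i w.1 * w.2 ^ i) / (w.1 ^ E * W₁ w.1) *
      (1 / w.2) ^ n) (Om g))
    (hpole : n ≠ 0 → ∀ w ∈ Om g, w.2 ≠ 0) :
    (∃ K, 1 ≤ K ∧ ∀ w ∈ Om g, |w.1| + |w.2| ≤ K * |w.2|) ∨
      (∀ i, i < n → i < N → ∀ u, Q i u = 0) := by
  have hQc : ∀ i, Continuous (Q i) := fun i => by
    rw [show Q i = fun u => ∑ m ∈ Finset.range N', c (i, m) * u ^ m from funext (hQ i)]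
    fun_prop
  by_cases hLB : (∃ j, aff (g j) 0 = 0 ∧ (g j).1 < 0) ∧ (∃ j, aff (g j) 0 = 0 ∧ 0 < (g j).1)
  · obtain ⟨⟨j, hj0, hj⟩, ⟨j', hj'0, hj'⟩⟩ := hLB
    obtain ⟨C, hC, hb⟩ := abs_fst_le g j j' hj0 hj hj'0 hj'
    refine Or.inl ⟨C + 1, by linarith, fun w hw => ?_⟩
    have := hb w hw; nlinarith [abs_nonneg w.2]
  · rcases Nat.eq_zero_or_pos n with hn | hn
    · exact Or.inr fun i hi => absurd hi (by omega)
    -- the ray `σ (1, 0)` lies in the closed active cone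
    have hray : ∃ σ : ℝ, (σ = 1 ∨ σ = -1) ∧ ∀ j, aff (g j) 0 = 0 → 0 ≤ σ * (g j).1 := by
      rcases not_and_or.1 hLB with h | h <;> push Not at h
      · exact ⟨1, Or.inl rfl, fun j hj => by simpa using h j hj⟩
      · exact ⟨-1, Or.inr rfl, fun j hj => by have := h j hj; linarith⟩
    obtain ⟨σ, hσ, hray⟩ := hray
    obtain ⟨p₀, hp₀⟩ := hne
    obtain ⟨a, b, η, J', hab, hη, hJ', h0ab, hsub, hbox⟩ :=
      exists_band_subset g h0 hσ hray p₀ hp₀ (hpole hn.ne' p₀ hp₀) hρW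
    have hvan := band_vanish Q hQc hη hJ' (fun w => w.1 ^ E * W₁ w.1) CW
      (fun w hw => ?_) (fun w hw => ?_) F (hF.mono_set hsub) (hFeq.mono hsub)
    · refine Or.inr fun i hi hiN u => ?_
      rw [hQ]
      exact poly_eq_zero_of_eqOn_Ioo (fun m => c (i, m)) N' hab
        (fun t ht => by rw [← hQ]; exact hvan i hi hiN t ht) u
    · obtain ⟨hw1, -⟩ := hbox w hw
      have hu1 : |w.1| ≤ 1 := (hw1.le.trans hρW1)
      rw [abs_mul, abs_pow]
      calc |w.1| ^ E * |W₁ w.1| ≤ 1 * CW :=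
            mul_le_mul (pow_le_one₀ (abs_nonneg _) hu1) (hWb w.1 hw1).2 (abs_nonneg _) zero_le_one
        _ = CW := one_mul _
    · obtain ⟨hw1, -⟩ := hbox w hw
      have hW : W₁ w.1 ≠ 0 := by
        have := (hWb w.1 hw1).1
        intro h; rw [h, abs_zero] at this; linarith [abs_pos.2 hW0]
      have hu : w.1 ≠ 0 := by
        have := hw.1
        rcases h0ab with h | h
        · exact ne_of_gt (h.trans this.1)
        · exact ne_of_lt (this.2.trans h)
      exact mul_ne_zero (pow_ne_zero _ hu) hW

/-- **The local core.** At a point of the pole line adherent to the polygon, every Taylor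
piece is absolutely integrable on the polygon near the point (power counting + band
vanishing). -/
theorem core (h0 : ∀ j, 0 ≤ aff (g j) 0) {N n E N' : ℕ} (c : ℕ × ℕ → ℝ) (Q : ℕ → ℝ → ℝ)
    (hQ : ∀ i u, Q i u = ∑ m ∈ Finset.range N', c (i, m) * u ^ m)
    (W₁ : ℝ → ℝ) (hW : Continuous W₁) (hW0 : W₁ 0 ≠ 0)
    (hE : E ≠ 0 → ∃ C, ∀ w ∈ Om g, |w.2| ≤ C * |w.1|)
    (F : ℝ × ℝ → ℝ) (hF : IntegrableOn F (Om g))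
    (hFeq : EqOn F (fun w => (∑ i ∈ Finset.range N, Q i w.1 * w.2 ^ i) / (w.1 ^ E * W₁ w.1) *
      (1 / w.2) ^ n) (Om g))
    (hpole : n ≠ 0 → ∀ w ∈ Om g, w.2 ≠ 0)
    (hlt : (Om g).Nonempty → ∀ D : ℕ,
      (∀ im ∈ Finset.range N ×ˢ Finset.range N', c im ≠ 0 → D ≤ im.1 + im.2) →
      (∃ im₀ ∈ Finset.range N ×ˢ Finset.range N', c im₀ ≠ 0 ∧ im₀.1 + im₀.2 = D) →
      n + E < D + 2) :
    ∀ i < N, ∃ ρ > 0, IntegrableOn (piece Q W₁ E n i) (Om g ∩ box ρ) := by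
  classical
  intro i hi
  have hQc : ∀ i, Continuous (Q i) := fun i => by
    rw [show Q i = fun u => ∑ m ∈ Finset.range N', c (i, m) * u ^ m from funext (hQ i)]
    fun_prop
  have hmeas := measurable_piece hQc hW E n i
  obtain ⟨ρW, hρW, CW, hCW, hρW1, hWb⟩ := W_bounds hW hW0
  have hW00 : 0 < |W₁ 0| := abs_pos.2 hW0
  -- trivial cases: empty polygon, vanishing piece
  have hzero : (∀ u, Q i u = 0) → ∃ ρ > 0, IntegrableOn (piece Q W₁ E n i) (Om g ∩ box ρ) :=
    fun hq => ⟨1, one_pos, integrableOn_Om_of_bdd g hmeas (C := 0) fun w _ => by simp [piece, hq]⟩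
  by_cases hne : (Om g).Nonempty
  swap
  · refine ⟨1, one_pos, ?_⟩
    rw [not_nonempty_iff_eq_empty.1 hne, empty_inter]; exact integrableOn_empty
  -- the bounded case `n = E = 0`
  by_cases hnE : n = 0 ∧ E = 0
  · obtain ⟨hn, hE0⟩ := hnE
    obtain ⟨CQ, hCQ⟩ := isCompact_Icc.exists_bound_of_continuousOn
      ((hQc i).continuousOn (s := Icc (-1 : ℝ) 1))
    refine ⟨ρW, hρW, integrableOn_Om_of_bdd g hmeas (C := CQ * (2 / |W₁ 0|)) fun w hw => ?_⟩
    obtain ⟨-, hw1, hw2⟩ := hw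
    have hQb : |Q i w.1| ≤ CQ := by
      have := hCQ w.1 (by rw [mem_Icc, ← abs_le]; exact hw1.le.trans hρW1)
      rwa [Real.norm_eq_abs] at this
    have hCQ0 : 0 ≤ CQ := (abs_nonneg _).trans hQb
    have hWl := (hWb w.1 hw1).1
    have hl : |w.2| ^ i ≤ 1 := pow_le_one₀ (abs_nonneg _) (hw2.le.trans hρW1)
    simp only [piece, hn, hE0, pow_zero, one_mul, div_one, abs_mul, abs_div, abs_pow]
    calc |Q i w.1| / |W₁ w.1| * |w.2| ^ i ≤ CQ / (|W₁ 0| / 2) * 1 := by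
          refine mul_le_mul ?_ hl (by positivity) (by positivity)
          exact div_le_div₀ hCQ0 hQb (by positivity) hWl
      _ = CQ * (2 / |W₁ 0|) := by field_simp
  have hnE' : n ≠ 0 ∨ E ≠ 0 := by tauto
  -- the order `D` of the numerator at the origin
  set T := Finset.range N ×ˢ Finset.range N' with hT
  by_cases hall : ∀ im ∈ T, c im = 0
  · refine hzero fun u => ?_
    rw [hQ]
    exact Finset.sum_eq_zero fun m hm => by
      rw [hall (i, m) (Finset.mem_product.2 ⟨Finset.mem_range.2 hi, hm⟩), zero_mul]
  push Not at hall
  set S₀ := (T.filter fun im => c im ≠ 0).image fun im => im.1 + im.2 with hS₀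
  have hS₀ne : S₀.Nonempty := by
    obtain ⟨im, him, hc⟩ := hall
    exact ⟨im.1 + im.2, Finset.mem_image.2 ⟨im, Finset.mem_filter.2 ⟨him, hc⟩, rfl⟩⟩
  set D := S₀.min' hS₀ne with hD
  have hd : ∀ im ∈ T, c im ≠ 0 → D ≤ im.1 + im.2 := fun im him hc =>
    Finset.min'_le _ _ (Finset.mem_image.2 ⟨im, Finset.mem_filter.2 ⟨him, hc⟩, rfl⟩)
  have him₀ : ∃ im₀ ∈ T, c im₀ ≠ 0 ∧ im₀.1 + im₀.2 = D := by
    obtain ⟨im₀, h1, h2⟩ := Finset.mem_image.1 (Finset.min'_mem S₀ hS₀ne)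
    exact ⟨im₀, (Finset.mem_filter.1 h1).1, (Finset.mem_filter.1 h1).2, h2⟩
  -- the dichotomy
  have hdich := dichotomy g c Q hQ W₁ hW0 hρW1 hWb h0 hne hρW F hF hFeq hpole
  by_cases hvan : i < n ∧ ∀ u, Q i u = 0
  · exact hzero hvan.2
  have hgood : ∃ K : ℝ, 1 ≤ K ∧ (n ≤ i ∨ ∀ w ∈ Om g, |w.1| + |w.2| ≤ K * |w.2|) := by
    rcases hdich with ⟨K, hK, hb⟩ | hq
    · exact ⟨K, hK, Or.inr hb⟩
    · refine ⟨1, le_rfl, Or.inl ?_⟩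
      by_contra hlt; push Not at hlt
      exact hvan ⟨hlt, hq i hlt hi⟩
  obtain ⟨K, hK, hgood⟩ := hgood
  have hcone : ∃ K₂ : ℝ, 1 ≤ K₂ ∧ (E ≠ 0 → ∀ w ∈ Om g, |w.1| + |w.2| ≤ K₂ * |w.1|) := by
    rcases Nat.eq_zero_or_pos E with hE0 | hE0
    · exact ⟨1, le_rfl, fun h => absurd hE0 h⟩
    · obtain ⟨C, hC⟩ := hE hE0.ne'
      refine ⟨max C 0 + 1, by linarith [le_max_right C 0], fun _ w hw => ?_⟩
      have h1 := hC w hw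
      have h2 : C * |w.1| ≤ max C 0 * |w.1| := mul_le_mul_of_nonneg_right (le_max_left _ _) (abs_nonneg _)
      linarith
  obtain ⟨K₂, hK₂, hcone⟩ := hcone
  -- upper and lower power bounds
  set ρ := ρW / 2 with hρ
  have hρpos : 0 < ρ := by positivity
  have hup := abs_piece_le g c Q hQ hd hi W₁ hW0 (ρ := ρ) (by linarith) (by linarith)
    (fun u hu => (hWb u hu).1) hnE' hpole hK hgood hK₂ hcone
  have hlt := hlt hne D hd him₀
  -- domination by the planar weight
  set C₁ := (∑ im ∈ T, |c im|) * K ^ n * K₂ ^ E * (2 / |W₁ 0|) with hC₁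
  have hC₁ : 0 ≤ C₁ := by positivity
  refine ⟨ρ, hρpos, Integrable.mono' (g := fun w => C₁ * (|w.1| + |w.2|)⁻¹) ?_
    hmeas.aestronglyMeasurable ?_⟩
  · refine ((integrableOn_inv_abs_add.mono_set ?_).mono_set inter_subset_right).const_mul C₁
    rw [box_eq]
    exact prod_mono (Ioo_subset_Ioo (by linarith) (by linarith))
      (Ioo_subset_Ioo (by linarith) (by linarith))
  · refine (ae_restrict_iff' ((measurableSet_Om g).inter (measurableSet_box ρ))).2
      (Eventually.of_forall fun w hw => ?_)
    rw [Real.norm_eq_abs]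
    refine (hup w hw).trans (mul_le_mul_of_nonneg_left ?_ hC₁)
    rcases (show 0 ≤ |w.1| + |w.2| by positivity).lt_or_eq with hr | hr
    · exact div_pow_le_inv hr (by obtain ⟨-, h1, h2⟩ := hw; linarith) (by omega)
    · rw [← hr]
      have : n + E ≠ 0 := by omega
      simp [zero_pow this]

end CoreThm

end SepTwoZero

open SepTwoZero in
/-- **The local core** (registered sub-goal of `stub_separateTwoZero`; see `SepTwoZero.core`). -/
theorem separateTwoZero_core {J : ℕ} (g : Fin J → ℝ × ℝ × ℝ) (h0 : ∀ j, 0 ≤ SepTwoZero.aff (g j) 0) {N n E N' : ℕ} (c : ℕ × ℕ → ℝ) (Q : ℕ → ℝ → ℝ) (hQ : ∀ i u, Q i u = ∑ m ∈ Finset.range N', c (i, m) * u ^ m) (W₁ : ℝ → ℝ) (hW : Continuous W₁) (hW0 : W₁ 0 ≠ 0) (hE : E ≠ 0 → ∃ C, ∀ w ∈ SepTwoZero.Om g, |w.2| ≤ C * |w.1|) (F : ℝ × ℝ → ℝ) (hF : IntegrableOn F (SepTwoZero.Om g)) (hFeq : EqOn F (fun w => (∑ i ∈ Finset.range N, Q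 i w.1 * w.2 ^ i) / (w.1 ^ E * W₁ w.1) * (1 / w.2) ^ n) (SepTwoZero.Om g)) (hpole : n ≠ 0 → ∀ w ∈ SepTwoZero.Om g, w.2 ≠ 0) (hlt : (SepTwoZero.Om g).Nonempty → ∀ D : ℕ, (∀ im ∈ Finset.range N ×ˢ Finset.range N', c im ≠ 0 → D ≤ im.1 + im.2) → (∃ im₀ ∈ Finset.range N ×ˢ Finset.range N', c im₀ ≠ 0 ∧ im₀.1 + im₀.2 = D) → n + E < D + 2) : ∀ i < N, ∃ ρ > 0, IntegrableOn (SepTwoZero.piece Q W₁ E n i) (SepTwoZero.Om g ∩ SepTwoZero.box ρ) := by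
  exact core g h0 c Q hQ W₁ hW hW0 hE F hF hFeq hpole hlt

end Summit.KontsevichZagierPeriods.ArrangementNormalForm.JanusBands
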